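import Summits.CriticalPhenomena.CardyFormulaZ2.Theorems.CardyIKTransportIKLinearTransportLine

/-!
# `stub_DiagramExchange`, part S1a: the gluing theorems (crux stmt-CriticalPhenomena-5076, line pinned-diagram-exchange)

The registered stub `stub_DiagramExchange : ∀ L [NeZero L], 3 ≤ L → DiagramExchangeAt L` is NOT proved in this
file. Its all-`L` proof is the train argument on the cylinder (plan: `work/stubs/DiagramExchange-plan.md`, every local
ingredient verified by exact enumeration); this file is part S1a of that plan (the gluing theorems); part S1b (the three
local identities INSERT/STEP/REMOVE as kernel-certified pinned-sum theorems `gadget_insert/step/remove`) is the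
companion Mathlib-only file `work/stubs/stub_DiagramExchange_Gadget.lean`; parts S1c (interface with `pinnedWeight`)
and S1d (twisted family, replacement theorem, chain) remain. Contents:

* §1 `monoGraph`, `mem_blockCluster_iff` — the monochromatic cluster of the vocabulary (`blockCluster`, reachability in
  an induced subgraph) is plain reachability in `blockGraph ⊓ monoGraph col`; this is the form in which the gluing
  theorem is applied (colours absorbed into the graphs).
* §2 `faceWeight`/`blockWeight` bookkeeping: a honeycomb face carrying the main diagonal kills the weight.
* §3 THE GLUING THEOREM (patch lemma), reachability form: if the context graph `C` has no edge at the patch interior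
  `U` and the patch graph `A` has all its outside endpoints in the patch boundary `B`, then reachability in `C ⊔ A`
  between cells outside `U` is reachability in `C ⊔ bdryGraph A B`, where `bdryGraph A B` is the graph on `B` recording
  `A`-reachability; hence two patches inducing the same reachability on `B` are interchangeable (`reachable_glue_congr`).
* §4 THE GLUING THEOREM, weighted form (`sum_glue`): Fubini + regrouping by the patch's boundary readout; two patches
  with the same diagram-resolved weights on their boundary (up to a scalar) give the same glued pinned sums.
-/

namespace Summit.CriticalPhenomena.CardyFormulaZ2.Theorems.IKLinearTransport.PinnedDiagramExchange

open scoped Classical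

/-! ## §1 Monochromatic reachability -/

/-- The "same colour" graph of a colouring: distinct cells of equal colour are adjacent. [folklore] -/
def monoGraph {V : Type*} (col : V → Bool) : SimpleGraph V where
  Adj x y := x ≠ y ∧ col x = col y
  symm := ⟨fun _ _ h => ⟨h.1.symm, h.2.symm⟩⟩
  loopless := ⟨fun _ h => h.1 rfl⟩

/-- Adjacency of `monoGraph`. [folklore] -/
theorem monoGraph_adj {V : Type*} (col : V → Bool) (x y : V) :
    (monoGraph col).Adj x y ↔ x ≠ y ∧ col x = col y := Iff.rfl

/-- Along a walk of `G ⊓ monoGraph col` the colour is constant. [folklore] -/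
theorem col_eq_of_reachable_inf_monoGraph {V : Type*} {G : SimpleGraph V} {col : V → Bool} {x y : V}
    (h : (G ⊓ monoGraph col).Reachable x y) : col y = col x := by
  rw [SimpleGraph.reachable_iff_reflTransGen] at h
  induction h with
  | refl => rfl
  | tail _ hbc ih =>
    rw [SimpleGraph.inf_adj, monoGraph_adj] at hbc
    exact hbc.2.2.symm.trans ih

/-- The vocabulary's monochromatic cluster (`blockCluster`: reachability inside the subgraph induced on the colour
class) is reachability in `blockGraph ⊓ monoGraph col`. [folklore] -/
theorem mem_blockCluster_iff (L : ℕ) (col : Fin 3 × ZMod L → Bool) (a : Fin 2 × ZMod L → Bool)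
    (x y : Fin 3 × ZMod L) :
    y ∈ blockCluster L col a x ↔ (blockGraph L a ⊓ monoGraph col).Reachable x y := by
  show (∃ h : col y = col x, ((blockGraph L a).induce {z | col z = col x}).Reachable ⟨x, rfl⟩ ⟨y, h⟩) ↔ _
  constructor
  · rintro ⟨h, hr⟩
    let φ : (blockGraph L a).induce {z | col z = col x} →g blockGraph L a ⊓ monoGraph col :=
      { toFun := fun v => v.1
        map_rel' := fun {u v} huv => by
          rw [SimpleGraph.inf_adj, monoGraph_adj]
          refine ⟨huv, fun heq => huv.ne (Subtype.ext heq), ?_⟩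
          exact u.2.trans v.2.symm }
    exact hr.map φ
  · intro hr
    rw [SimpleGraph.reachable_iff_reflTransGen] at hr
    induction hr with
    | refl => exact ⟨rfl, SimpleGraph.Reachable.refl _⟩
    | tail _ hbc ih =>
      obtain ⟨hb, hrb⟩ := ih
      rw [SimpleGraph.inf_adj, monoGraph_adj] at hbc
      refine ⟨hbc.2.2.symm.trans hb, hrb.trans (SimpleGraph.Adj.reachable ?_)⟩
      exact hbc.1

/-! ## §2 Face-weight bookkeeping -/

/-- A honeycomb face (`iso = false`) carrying the MAIN diagonal (`antiFlag = false`) has weight `0`. [folklore] -/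
theorem faceWeight_hc_main (odd : Bool) : faceWeight false odd false = 0 := by
  simp [faceWeight]

/-- A honeycomb face carrying the anti-diagonal has weight `1`, whatever its parity. [folklore] -/
theorem faceWeight_hc_anti (odd : Bool) : faceWeight false odd true = 1 := by
  simp [faceWeight]

/-- An isotropic face has weight `(√3/2)^{odd} / 2` for each flag value (the flag is a fair coin). [folklore] -/
theorem faceWeight_iso (odd flag : Bool) :
    faceWeight true odd flag = (if odd then Real.sqrt 3 / 2 else 1) / 2 := by
  simp [faceWeight]

/-- If some honeycomb face column carries a main diagonal, the block weight vanishes. [folklore] -/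
theorem blockWeight_eq_zero_of_hc_main (L : ℕ) [NeZero L] (τ : Fin 2 → Bool) (col : Fin 3 × ZMod L → Bool)
    (a : Fin 2 × ZMod L → Bool) (f : Fin 2 × ZMod L) (hτ : τ f.1 = false) (ha : a f = false) :
    blockWeight L τ col a = 0 := by
  unfold blockWeight
  exact Finset.prod_eq_zero (Finset.mem_univ f) (by rw [hτ, ha]; exact faceWeight_hc_main _)

/-! ## §3 The gluing theorem (patch lemma), reachability form -/

section Glue

variable {V : Type*}

/-- The graph on the patch boundary `B` recording reachability THROUGH the patch graph `A`. [folklore] -/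
def bdryGraph (A : SimpleGraph V) (B : Set V) : SimpleGraph V where
  Adj p q := p ≠ q ∧ p ∈ B ∧ q ∈ B ∧ A.Reachable p q
  symm := ⟨fun _ _ h => ⟨h.1.symm, h.2.2.1, h.2.1, h.2.2.2.symm⟩⟩
  loopless := ⟨fun _ h => h.1 rfl⟩

/-- Adjacency of `bdryGraph`. [folklore] -/
theorem bdryGraph_adj (A : SimpleGraph V) (B : Set V) (p q : V) :
    (bdryGraph A B).Adj p q ↔ p ≠ q ∧ p ∈ B ∧ q ∈ B ∧ A.Reachable p q := Iff.rfl

/-- `bdryGraph A B` only depends on the reachability `A` induces on `B`. [folklore] -/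
theorem bdryGraph_congr {A A' : SimpleGraph V} {B : Set V}
    (h : ∀ p q, p ∈ B → q ∈ B → (A.Reachable p q ↔ A'.Reachable p q)) : bdryGraph A B = bdryGraph A' B := by
  ext p q
  rw [bdryGraph_adj, bdryGraph_adj]
  constructor
  · rintro ⟨hne, hp, hq, hr⟩; exact ⟨hne, hp, hq, (h p q hp hq).1 hr⟩
  · rintro ⟨hne, hp, hq, hr⟩; exact ⟨hne, hp, hq, (h p q hp hq).2 hr⟩

/-- If every edge of `H` is a `G`-reachable pair, `H`-reachability implies `G`-reachability. [folklore] -/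
theorem reachable_of_adj_reachable {G H : SimpleGraph V} (h : ∀ a b, H.Adj a b → G.Reachable a b) {u v : V}
    (huv : H.Reachable u v) : G.Reachable u v := by
  rw [SimpleGraph.reachable_iff_reflTransGen] at huv
  induction huv with
  | refl => rfl
  | tail _ hbc ih => exact ih.trans (h _ _ hbc)

/-- The invariant of the gluing induction: a `C ⊔ A`-walk ending outside the patch interior `U` either starts inside
`U` and then leaves the patch through a boundary cell `b ∈ B` reached inside `A`, or starts outside `U` and is already a
`C ⊔ bdryGraph A B`-reachability. [folklore] -/
theorem glue_walk_invariant (U B : Set V) (C A : SimpleGraph V)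
    (hC : ∀ v w, C.Adj v w → v ∉ U) (hA : ∀ v w, A.Adj v w → v ∉ U → v ∈ B)
    {v w : V} (p : (C ⊔ A).Walk v w) (hw : w ∉ U) :
    (v ∈ U → ∃ b, b ∈ B ∧ A.Reachable v b ∧ (C ⊔ bdryGraph A B).Reachable b w) ∧
      (v ∉ U → (C ⊔ bdryGraph A B).Reachable v w) := by
  induction p with
  | nil => exact ⟨fun hv => (hw hv).elim, fun _ => SimpleGraph.Reachable.refl _⟩
  | @cons u v' w' huv p ih =>
    have ih' := ih hw
    have hA' : ∀ a b, A.Adj a b → b ∉ U → b ∈ B := fun a b hab hb => hA b a hab.symm hb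
    -- an edge with an endpoint in `U` is an `A`-edge
    have hedgeU : u ∈ U ∨ v' ∈ U → A.Adj u v' := by
      intro hU
      rcases (SimpleGraph.sup_adj _ _ _ _).1 huv with hc | ha
      · rcases hU with hu | hv'
        · exact (hC u v' hc hu).elim
        · exact (hC v' u hc.symm hv').elim
      · exact ha
    constructor
    · intro hu
      have ha : A.Adj u v' := hedgeU (Or.inl hu)
      by_cases hv' : v' ∈ U
      · obtain ⟨b, hbB, hrb, hbw⟩ := ih'.1 hv'
        exact ⟨b, hbB, ha.reachable.trans hrb, hbw⟩
      · exact ⟨v', hA' u v' ha hv', ha.reachable, ih'.2 hv'⟩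
    · intro hu
      by_cases hv' : v' ∈ U
      · have ha : A.Adj u v' := hedgeU (Or.inr hv')
        have huB : u ∈ B := hA u v' ha hu
        obtain ⟨b, hbB, hrb, hbw⟩ := ih'.1 hv'
        have hub : A.Reachable u b := ha.reachable.trans hrb
        by_cases heq : u = b
        · subst heq; exact hbw
        · have hadj : (C ⊔ bdryGraph A B).Adj u b :=
            (SimpleGraph.sup_adj _ _ _ _).2 (Or.inr ((bdryGraph_adj A B u b).2 ⟨heq, huB, hbB, hub⟩))
          exact hadj.reachable.trans hbw
      · have hstep : (C ⊔ bdryGraph A B).Reachable u v' := by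
          rcases (SimpleGraph.sup_adj _ _ _ _).1 huv with hc | ha
          · exact ((SimpleGraph.sup_adj _ _ _ _).2 (Or.inl hc) : (C ⊔ bdryGraph A B).Adj u v').reachable
          · have hadj : (C ⊔ bdryGraph A B).Adj u v' :=
              (SimpleGraph.sup_adj _ _ _ _).2
                (Or.inr ((bdryGraph_adj A B u v').2 ⟨ha.ne, hA u v' ha hu, hA' u v' ha hv', ha.reachable⟩))
            exact hadj.reachable
        exact hstep.trans (ih'.2 hv')

/-- GLUING THEOREM, reachability form. Context graph `C` without edges at the patch interior `U`; patch graph `A` whose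
edges leaving `U` (or lying outside `U`) end in the patch boundary `B`. Then between cells outside `U`, reachability in
the glued graph `C ⊔ A` is reachability in `C ⊔ bdryGraph A B`: the patch enters only through the reachability it
induces on its boundary cells. [folklore] -/
theorem reachable_glue_iff (U B : Set V) (C A : SimpleGraph V)
    (hC : ∀ v w, C.Adj v w → v ∉ U) (hA : ∀ v w, A.Adj v w → v ∉ U → v ∈ B)
    {v w : V} (hv : v ∉ U) (hw : w ∉ U) :
    (C ⊔ A).Reachable v w ↔ (C ⊔ bdryGraph A B).Reachable v w := by
  constructor
  · rintro ⟨p⟩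
    exact (glue_walk_invariant U B C A hC hA p hw).2 hv
  · intro h
    refine reachable_of_adj_reachable (fun a b hab => ?_) h
    rcases (SimpleGraph.sup_adj _ _ _ _).1 hab with hc | hb
    · exact ((SimpleGraph.sup_adj _ _ _ _).2 (Or.inl hc) : (C ⊔ A).Adj a b).reachable
    · exact ((bdryGraph_adj A B a b).1 hb).2.2.2.mono le_sup_right

/-- GLUING THEOREM, congruence form: two patch graphs `A`, `A'` (both with outside endpoints in `B`) that induce the
same reachability on the patch boundary `B` give glued graphs `C ⊔ A`, `C ⊔ A'` with the same reachability between
cells outside the patch interior. This is the "replace a patch by a patch with the same boundary connectivity diagram"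
lemma of the train argument. [folklore] -/
theorem reachable_glue_congr (U B : Set V) (C A A' : SimpleGraph V)
    (hC : ∀ v w, C.Adj v w → v ∉ U) (hA : ∀ v w, A.Adj v w → v ∉ U → v ∈ B)
    (hA' : ∀ v w, A'.Adj v w → v ∉ U → v ∈ B)
    (hloc : ∀ p q, p ∈ B → q ∈ B → (A.Reachable p q ↔ A'.Reachable p q))
    {v w : V} (hv : v ∉ U) (hw : w ∉ U) :
    (C ⊔ A).Reachable v w ↔ (C ⊔ A').Reachable v w := by
  rw [reachable_glue_iff U B C A hC hA hv hw, reachable_glue_iff U B C A' hC hA' hv hw, bdryGraph_congr hloc]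

/-- Colours absorbed into graphs: `(C ⊔ A) ⊓ M = (C ⊓ M) ⊔ (A ⊓ M)` (used with `M = monoGraph col`). [folklore] -/
theorem sup_inf_distrib_graph (C A M : SimpleGraph V) : (C ⊔ A) ⊓ M = (C ⊓ M) ⊔ (A ⊓ M) :=
  inf_sup_right C A M

end Glue

/-! ## §4 The gluing theorem, weighted form (Fubini + regrouping by the patch's boundary readout) -/

section WeightedGlue

open Finset

/-- Regroup a weighted sum by the fibres of a readout `ρ`. [folklore] -/
theorem sum_fiber_regroup {Y R : Type*} [Fintype Y] [DecidableEq R] (w : Y → ℝ) (ρ : Y → R) (F : R → ℝ)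
    (t : Finset R) (ht : ∀ y, ρ y ∈ t) :
    ∑ y, w y * F (ρ y) = ∑ r ∈ t, (∑ y ∈ univ.filter (fun y => ρ y = r), w y) * F r := by
  rw [← sum_fiberwise_of_maps_to (s := univ) (t := t) (g := ρ) (fun y _ => ht y)]
  refine sum_congr rfl fun r _ => ?_
  rw [sum_mul]
  refine sum_congr rfl fun y hy => ?_
  rw [(mem_filter.1 hy).2]

/-- GLUING THEOREM, weighted form. `x` = context data, `y`/`y'` = interior data of the two patches, `ρ`/`ρ'` = the
readout of the patch on its boundary (its connectivity diagram on `B`, any type with decidable equality), `F x r` =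
everything downstream (context weight × indicator that the global diagram — a function of `x` and `r` alone, by
`reachable_glue_iff` — is the prescribed one). If the two patches have the same `ρ`-resolved ("pinned") weights up to
the scalar `s`, the glued sums agree up to `s`. [folklore] -/
theorem sum_glue : ∀ {X Y Y' R : Type*} [Fintype X] [Fintype Y] [Fintype Y'] [DecidableEq R]
    (wA : X → Y → ℝ) (wA' : X → Y' → ℝ) (ρ : X → Y → R) (ρ' : X → Y' → R) (F : X → R → ℝ) (s : ℝ),
    (∀ x r, ∑ y ∈ Finset.univ.filter (fun y => ρ x y = r), wA x y =
      s * ∑ y' ∈ Finset.univ.filter (fun y' => ρ' x y' = r), wA' x y') →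
    ∑ x, ∑ y, wA x y * F x (ρ x y) = s * ∑ x, ∑ y', wA' x y' * F x (ρ' x y') := by
  intro X Y Y' R _ _ _ _ wA wA' ρ ρ' F s hloc
  rw [mul_sum]
  refine sum_congr rfl fun x _ => ?_
  set t : Finset R := univ.image (ρ x) ∪ univ.image (ρ' x) with ht
  rw [sum_fiber_regroup (wA x) (ρ x) (F x) t
      (fun y => mem_union_left _ (mem_image_of_mem _ (mem_univ y))),
    sum_fiber_regroup (wA' x) (ρ' x) (F x) t
      (fun y => mem_union_right _ (mem_image_of_mem _ (mem_univ y))),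
    mul_sum]
  refine sum_congr rfl fun r _ => ?_
  rw [hloc x r, mul_assoc]

end WeightedGlue

end Summit.CriticalPhenomena.CardyFormulaZ2.Theorems.IKLinearTransport.PinnedDiagramExchange
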